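import Mathlib
import HarnessLib
import Summits.Ventures.LatticeQCDFlow.Scoring.RegenerativeMedianOfGroupsGeneral
import Summits.Ventures.LatticeQCDFlow.Scoring.RegenerativeEstimatorSigma
import Summits.Ventures.LatticeQCDFlow.Exactness.ApproxTrivializingSampler

/-!
# Median of tour-group estimates AT THE CLT SCALE: `P(#{bad groups} ≥ K/2) ≤ e^{−K/8}` as soon as
# `m ≥ 16 (ε σ²_f/s² + 1 − ε)` tours per group — exponential, variance-sensitive, CLT-free, one run

HONEST FRAMING: exact (Metropolis-corrected) sampling algorithms for lattice gauge theory;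
figures of merit are autocorrelation/cost numbers at stated couplings and volumes; no
continuum-physics claim.

Venture `LatticeQCDFlow` (cell pub-lqcd), topic `Scoring`; FANOUT row 8 (`s0-cpn-nemc`, GEN-17).
NEW WORK of the cell, not a published result; no definition is introduced.  Notation of
`Scoring/RegenerativeMedianOfGroups.lean`: groups of `m` tours with one spacer tour, group estimates
`A_k`, `χ_k = 1{s ≤ |A_k − π(f)|}`; `σ²_f = ∫ f̄² dπ + 2 Σ_{k≥1} ∫ f̄ K^k f̄ dπ` the Green–Kubo
asymptotic variance.  GEN-16's certificate needed `m ≥ 16((2−ε)(2C)²/s² + 1 − ε)` tours per group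
(worst-case second moment).  Composing the general form `Scoring/RegenerativeMedianOfGroupsGeneral.lean`
with the variance-sensitive any-start group bound `4(ε σ²_f/s² + (1−ε))/m` of
`Scoring/RegenerativeEstimatorSigma.lean` (itself resting on GEN-17's `ε E_ν̂[Z_0²] = σ²_f` for every
minorising law): if `4(ε σ²_f/s² + (1−ε))/m ≤ 1/4` then `P(Σ_{k<K} χ_k ≥ K/2) ≤ e^{−K/8}` from ANY
start — the deviation `s` of the median group estimate is at the CLT scale `σ_f √(ε/m) ≈ σ_f/√n_group`
(`n_group ≈ m/ε` samples per group) with EXPONENTIAL confidence in the number of groups, using no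
variance estimate, no autocorrelation time and no CLT.  General-state-space instance: independence
Metropolis with log-weight oscillation `≤ M`, `ε = e^{−M}`.  Printed counterpart NAMED ONLY:
median-of-means estimators with sub-Gaussian deviations at the variance scale (Nemirovsky–Yudin 1983;
Devroye–Lerasle–Lugosi–Oliveira 2016, Ann. Statist. 44) — here for ONE Markov-chain run via
regeneration tours (Mykland–Tierney–Yu 1995); nothing is cited as a fact.

## Content (`e = ε.toReal`; `0 < ε < 1`; `π` invariant; `|f| ≤ C`; any initial law; `m ≥ 1`, `s > 0`)

* **`regenerative_medianOfGroups_confidence_sigma`** — if `4(e σ²_f/s² + (1−e))/m ≤ 1/4` then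
  `P((K : ℝ)/2 ≤ Σ_{k<K} χ_k) ≤ exp(−K/8)` for every `K`;
* **`indepMH_regenerative_medianOfGroups_sigma`** — the same for `indepMH q (1/ρ)`, `q = ρ·π`,
  `ρ x ≤ e^{M} ρ y`, at `ε = e^{−M}`.

NOT CLAIMED: optimal constants (`16`, `1/8`); any `ε`/`M` of a concrete sampler; observability of the
regeneration coins (a statement about laws).
-/

noncomputable section

namespace Summit.Ventures.LatticeQCDFlow.Scoring

open MeasureTheory ProbabilityTheory Filter Finset Preorder Summit.Ventures.LatticeQCDFlow.Exactness
open Literature.Probability.MarkovChains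
open scoped ENNReal

section Sigma

variable {Ω : Type*} [MeasurableSpace Ω]
  {κ : Kernel Ω Ω} [IsMarkovKernel κ] {ν : Measure Ω} [IsProbabilityMeasure ν] {ε : ℝ≥0∞}
  {hmin : ∀ x {B : Set Ω}, MeasurableSet B → ε * ν B ≤ κ x B}
  (κs : Kernel (Ω × Bool) (Ω × Bool)) [IsMarkovKernel κs]
  (μs : Measure (Ω × Bool)) [IsProbabilityMeasure μs]

/-- **MEDIAN OF TOUR GROUPS AT THE CLT SCALE.**  `π` invariant, `κ(x, ·) ≥ ε ν` with `0 < ε < 1`,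
`|f| ≤ C` measurable, any initial law, `m ≥ 1`, `s > 0`,
`σ²_f = ∫ f̄² dπ + 2 ∑' k, ∫ f̄ (kop κ)^[k+1] f̄ dπ`.  If `4 (e σ²_f/s² + (1 − e))/m ≤ 1/4` then for every `K`:
`P((K : ℝ)/2 ≤ Σ_{k<K} χ_k) ≤ exp(−K/8)`. -/
theorem regenerative_medianOfGroups_confidence_sigma {π : Measure Ω} [IsProbabilityMeasure π]
    (hπ : Kernel.Invariant κ π) (hε0 : 0 < ε) (hε : ε < 1)
    (hκs : ∀ p, κs p = (ε • ν).map (fun y : Ω => (y, true))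
      + ((1 - ε) • Doeblin.residualKernel κ ν ε hmin p.1).map (fun y : Ω => (y, false)))
    {f : Ω → ℝ} (hf : Measurable f) {C : ℝ} (hC : ∀ x, |f x| ≤ C) {m : ℕ} (hm : 0 < m)
    {s : ℝ} (hs : 0 < s)
    (hq : 4 * (ε.toReal * ((∫ y, (f y - ∫ z, f z ∂π) ^ 2 ∂π)
          + 2 * ∑' k, ∫ y, (f y - ∫ z, f z ∂π) * (kop κ)^[k + 1] (fun y => f y - ∫ z, f z ∂π) y ∂π)
          / s ^ 2 + (1 - ε.toReal)) / m ≤ 1 / 4) (K : ℕ) :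
    (Kernel.trajMeasure (X := fun _ : ℕ => Ω × Bool) μs
        (fun n : ℕ => κs.comap (fun h : (i : ↥(Finset.Iic n)) → Ω × Bool =>
          h ⟨n, Finset.mem_Iic.2 le_rfl⟩) (measurable_pi_apply _))).real
      {x | (K : ℝ) / 2 ≤ ∑ k ∈ Finset.range K,
        (if s ≤ |(∑ i ∈ Finset.range m, ∑' u, (if (∑ s ∈ Finset.range u,
              (if (x (s + 1)).2 then (1 : ℕ) else 0)) = k * (m + 1) + i + 1 then (1 : ℝ) else 0)
              * f (x u).1)
            / (∑ i ∈ Finset.range m, ∑' u, (if (∑ s ∈ Finset.range u,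
              (if (x (s + 1)).2 then (1 : ℕ) else 0)) = k * (m + 1) + i + 1 then (1 : ℝ) else 0))
            - ∫ z, f z ∂π| then (1 : ℝ) else 0)}
      ≤ Real.exp (-((K : ℝ) / 8)) := by
  have he1 : ε.toReal ≤ 1 := by
    have := (ENNReal.toReal_lt_toReal (ne_top_of_lt hε) ENNReal.one_ne_top).2 hε
    rw [ENNReal.toReal_one] at this
    exact this.le
  have hσ := asymptoticVariance_nonneg_minorised (κ := κ) (ν := ν) hπ hmin hε0 hε hf hC
  have hq0 : 0 ≤ 4 * (ε.toReal * ((∫ y, (f y - ∫ z, f z ∂π) ^ 2 ∂π)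
      + 2 * ∑' k, ∫ y, (f y - ∫ z, f z ∂π) * (kop κ)^[k + 1] (fun y => f y - ∫ z, f z ∂π) y ∂π)
      / s ^ 2 + (1 - ε.toReal)) / m := by
    have h1 : 0 ≤ 1 - ε.toReal := by linarith
    have h2 : 0 ≤ ε.toReal * ((∫ y, (f y - ∫ z, f z ∂π) ^ 2 ∂π)
        + 2 * ∑' k, ∫ y, (f y - ∫ z, f z ∂π) * (kop κ)^[k + 1] (fun y => f y - ∫ z, f z ∂π) y ∂π) :=
      mul_nonneg ENNReal.toReal_nonneg hσ
    positivity
  exact regenerative_medianOfGroups_of_groupBound κs μs (κ := κ) (ν := ν) (hmin := hmin) hε0 hε hκs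
    hf m hq0 hq (fun μ' _ => regenerative_estimator_confidence_sigma κs μ' (κ := κ) (ν := ν)
      (hmin := hmin) hπ hε0 hε hκs hf hC hm hs) K

end Sigma

/-- **Median of tour groups at the CLT scale for an independence Metropolis run** with log-weight
oscillation `≤ M` (`ε = e^{−M}`), any start. -/
theorem indepMH_regenerative_medianOfGroups_sigma {Ω : Type*} [MeasurableSpace Ω]
    {π q : Measure Ω} [IsProbabilityMeasure π]
    [IsProbabilityMeasure q] {ρ : Ω → ℝ} (hρm : Measurable ρ) (hρ0 : ∀ x, 0 < ρ x)
    (hq : q = π.withDensity fun x => ENNReal.ofReal (ρ x)) {M : ℝ} (hM0 : 0 < M)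
    (hM : ∀ x y, ρ x ≤ Real.exp M * ρ y)
    (κs : Kernel (Ω × Bool) (Ω × Bool)) [IsMarkovKernel κs]
    (hκs : haveI : Fact (Measurable fun x => (ρ x)⁻¹) := ⟨hρm.inv⟩
      ∀ p, κs p = (ENNReal.ofReal (Real.exp (-M)) • π).map (fun y : Ω => (y, true))
        + ((1 - ENNReal.ofReal (Real.exp (-M))) • Doeblin.residualKernel
            (indepMH q fun x => (ρ x)⁻¹) π (ENNReal.ofReal (Real.exp (-M)))
            (fun x _ hB => (indepMH_exact_doeblin_of_density_ratio hρm hρ0 hq hM).2.2 x hB) p.1).map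
          (fun y : Ω => (y, false)))
    (μs : Measure (Ω × Bool)) [IsProbabilityMeasure μs]
    {f : Ω → ℝ} (hf : Measurable f) {C : ℝ} (hC : ∀ x, |f x| ≤ C) {m : ℕ} (hm : 0 < m)
    {s : ℝ} (hs : 0 < s)
    (hsmall : haveI : Fact (Measurable fun x => (ρ x)⁻¹) := ⟨hρm.inv⟩
      4 * (Real.exp (-M) * ((∫ y, (f y - ∫ z, f z ∂π) ^ 2 ∂π)
          + 2 * ∑' k, ∫ y, (f y - ∫ z, f z ∂π)
            * (kop (indepMH q fun x => (ρ x)⁻¹))^[k + 1] (fun y => f y - ∫ z, f z ∂π) y ∂π)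
          / s ^ 2 + (1 - Real.exp (-M))) / m ≤ 1 / 4)
    (K : ℕ) :
    (Kernel.trajMeasure (X := fun _ : ℕ => Ω × Bool) μs
        (fun n : ℕ => κs.comap (fun h : (i : ↥(Finset.Iic n)) → Ω × Bool =>
          h ⟨n, Finset.mem_Iic.2 le_rfl⟩) (measurable_pi_apply _))).real
      {x | (K : ℝ) / 2 ≤ ∑ k ∈ Finset.range K,
        (if s ≤ |(∑ i ∈ Finset.range m, ∑' u, (if (∑ s ∈ Finset.range u,
              (if (x (s + 1)).2 then (1 : ℕ) else 0)) = k * (m + 1) + i + 1 then (1 : ℝ) else 0)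
              * f (x u).1)
            / (∑ i ∈ Finset.range m, ∑' u, (if (∑ s ∈ Finset.range u,
              (if (x (s + 1)).2 then (1 : ℕ) else 0)) = k * (m + 1) + i + 1 then (1 : ℝ) else 0))
            - ∫ z, f z ∂π| then (1 : ℝ) else 0)}
      ≤ Real.exp (-((K : ℝ) / 8)) := by
  haveI : Fact (Measurable fun x => (ρ x)⁻¹) := ⟨hρm.inv⟩
  obtain ⟨hinv, -, hdoeb⟩ := indepMH_exact_doeblin_of_density_ratio hρm hρ0 hq hM
  have hε0 : 0 < ENNReal.ofReal (Real.exp (-M)) := ENNReal.ofReal_pos.2 (Real.exp_pos _)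
  have hε1 : ENNReal.ofReal (Real.exp (-M)) < 1 := by
    rw [ENNReal.ofReal_lt_one]
    exact Real.exp_lt_one_iff.2 (by linarith)
  have hr : (ENNReal.ofReal (Real.exp (-M))).toReal = Real.exp (-M) :=
    ENNReal.toReal_ofReal (Real.exp_pos _).le
  have h := regenerative_medianOfGroups_confidence_sigma κs μs (κ := indepMH q fun x => (ρ x)⁻¹)
    (ν := π) (hmin := fun x _ hB => hdoeb x hB) hinv hε0 hε1 hκs hf hC hm hs
    (by rw [hr]; exact hsmall) K
  exact h

end Summit.Ventures.LatticeQCDFlow.Scoring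

end
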